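import Literature.NumberTheory.EllipticCurves.IsogenyQuadraticTwistProofs
import Literature.NumberTheory.EllipticCurves.QuadraticTwistJInvariantProofs
import Literature.NumberTheory.EllipticCurves.BSDInvariantsProofs
import Literature.NumberTheory.EllipticCurves.TateModuleBaseChange
import Literature.NumberTheory.EllipticCurves.Kato2004.EulerSystemValues
import Literature.NumberTheory.GaloisRepresentations.DecompositionFieldRigidity
import Literature.NumberTheory.EllipticCurves.TwoDescentLocalSelmerOfExhibit
import HarnessLib

/-!
# Route `TwoAdicConverse` (rung S3), crux `OrdLambdaHalfAtTwo` (item stmt-BirchSwinnertonDyer-19556), line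
# `kato-determinant-greenberg-two`: carrier want C5, POINT AND TATE-MODULE LEVEL — the GEOMETRIC UNTWISTING
# `A(F̄) ≃+ W(F̄)` for `C • A = W^{(d)}` and its Galois law, and the induced `ℤ_p`-isomorphism `T_p A ≃ T_p W`

Seat `cruxlead-stmt-BirchSwinnertonDyer-19556-g1` (LEAD PROVER, MODE LINE; `--supports` stmt-BirchSwinnertonDyer-19556, helper).  HONEST FRAMING
(cell bsd-2adic): BSD is not proved by any of this; the crux is NOT proved here; nothing about any particular curve is asserted; definitions
with bodies and proved theorems only; no named fact, no instance, no `sorry`.  PURPOSE: the pinned Kato–Greenberg datum of skeleton v4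
(`TwoAdicConverseOrdLambdaHalfAtTwoPinnedDatumDefs`, p674487) takes the local untwisting `u_A : T₂A|_{Γ_{ℚ₂}} ⟶ T₂W|_{Γ_{ℚ₂}}` as a POSITED
parameter (carrier want C5 of the lead's RECUT memo 2 / HANDOFF typing brief).  This file builds its GEOMETRIC source: for Weierstrass curves
`A, W` over a field `F` with `2 ≠ 0` and `C • A = W.quadraticTwist d` (`d ≠ 0`), the composite
`Θ = (geomPointsEquiv W toCharNeTwoNF)⁻¹ ∘ untwistEquiv W₀ ∘ (cast W^{(d)} = W₀^{(d)}) ∘ (cast C • A = W^{(d)}) ∘ geomPointsEquiv A C`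
(`W₀ = W.toCharNeTwoNF • W` the completed-square model; all pieces are tree isomorphisms), its Galois law
`Θ(σ • P) = σ • Θ(P)` whenever `σ(√d) = √d` (and `= −σ • Θ(P)` when `σ(√d) = −√d`), and `T_p Θ : T_p A ≃ₗ[ℤ_p] T_p W` with the same law —
so that over any field into which `√d` descends (`ℚ₂` for a Greenberg field `K`, `d_K ≡ 1 (mod 8)`) the decomposition group acts compatibly.
§5 packages `T_p Θ` as a morphism of the LOCAL topological representations `(tateRep A p).toLocal v ⟶ (tateRep W p).toLocal v` at any place
`v` into whose completion `√d` descends under the chosen embedding (hypothesis `hsq`; continuity by `TateModule.continuous_map`, equivariance by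
`absGaloisRestrict_smul_eq_of_mem_range`) — `twistLocalHom`, bijective (`twistLocalHom_bijective`): the geometric value of the parameter `uA` of
`PinnedKatoGreenbergDatum`.  §6 discharges `hsq`: in general from `IsSquare (algebraMap ℚ ℚ_v d)`
(`absClosureEmbedding_geomSqrt_mem_range`) and at `v = (2)` for an integer `D ≡ 1 (mod 8)` (Hensel at `2`, tree lemmas) — the Greenberg-field
case `d_K ≡ 1 (mod 8)` (`TwoAdicGreenbergTwist.discr_emod_eight_of_greenbergField`).

References: J. H. Silverman, *AEC* (2009) X.2 Prop. 2.4, X.5 Cor. 5.4, III.§7 [SilvermanAEC2009]; tree `IsogenyQuadraticTwistProofs`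
(`untwistEquiv`, `untwistEquiv_smul_of_eq/_of_eq_neg`), `QuadraticTwistJInvariantProofs` (`quadraticTwist_smul`), `BSDInvariantsProofs`
(`geomPointsEquiv`, `geomPointsEquiv_smul`), `TateModule` (`TateModule.map`).
-/

set_option linter.dupNamespace false
set_option autoImplicit false

noncomputable section

open scoped Classical
open WeierstrassCurve
open Literature.NumberTheory.EllipticCurves

namespace Summit.BirchSwinnertonDyer.BirchSwinnertonDyer.Theorems.TwoAdicKatoDeterminant

universe u

variable {F : Type u} [Field F]

/-! ## §1 Points of equal curves -/

/-- The identification of geometric points of two EQUAL Weierstrass curves (transport along the equality). [folklore] -/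
def geomPointsCongr {X Y : WeierstrassCurve F} (h : X = Y) : X.geomPoints ≃+ Y.geomPoints :=
  h ▸ AddEquiv.refl X.geomPoints

/-- `geomPointsCongr` is `Γ_F`-equivariant. [folklore] -/
theorem geomPointsCongr_smul {X Y : WeierstrassCurve F} (h : X = Y) (σ : Field.absoluteGaloisGroup F) (P : X.geomPoints) :
    geomPointsCongr h (σ • P) = σ • geomPointsCongr h P := by
  subst h
  rfl

/-! ## §2 The completed-square model has the same quadratic twists -/

/-- `(W.toCharNeTwoNF • W)^{(d)} = W^{(d)}`: the twist is defined through the `b`-invariants of the completed-square model, and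
`toCharNeTwoNF = (1, 0, −a₁/2, −a₃/2)` has `u = 1`, `r = 0` (tree `quadraticTwist_smul`). [cite: SilvermanAEC2009, X.2 Prop. 2.4] -/
theorem quadraticTwist_toCharNeTwoNF_smul [Invertible (2 : F)] (W : WeierstrassCurve F) (d : F) :
    (W.toCharNeTwoNF • W).quadraticTwist d = W.quadraticTwist d := by
  rw [quadraticTwist_smul]
  have h1 : (⟨W.toCharNeTwoNF.u, d * W.toCharNeTwoNF.r, 0, 0⟩ : VariableChange F) = 1 := by
    ext <;> simp [toCharNeTwoNF, VariableChange.one_def]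
  rw [h1, one_smul]

/-! ## §3 The geometric untwisting `Θ : A(F̄) ≃+ W(F̄)` for `C • A = W^{(d)}` -/

section Untwist

variable [Invertible (2 : F)] [NeZero (2 : F)] (W A : WeierstrassCurve F) (C : VariableChange F) {d : F} (hd : d ≠ 0)
  (hA : C • A = W.quadraticTwist d)

/-- **The geometric untwisting** `Θ : A(F̄) ≃+ W(F̄)` attached to an `F`-isomorphism `C • A = W^{(d)}`: over `F̄ ∋ √d`,
`A ≅ W^{(d)} = W₀^{(d)} ≅ W₀ ≅ W` (`W₀` the completed-square model).  [cite: SilvermanAEC2009, X.5 Cor. 5.4] -/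
def twistGeomEquiv : A.geomPoints ≃+ W.geomPoints :=
  ((((geomPointsEquiv A C).trans (geomPointsCongr hA)).trans
      (geomPointsCongr (quadraticTwist_toCharNeTwoNF_smul W d).symm)).trans
    (untwistEquiv (W.toCharNeTwoNF • W) hd)).trans
    (geomPointsEquiv W W.toCharNeTwoNF).symm

/-- **Galois law of `Θ`, `+` case**: `Θ(σ • P) = σ • Θ(P)` for every `σ ∈ Γ_F` fixing `√d` (so `Θ` is `Γ_{F(√d)}`-equivariant; in
particular it is equivariant for any decomposition group at a place where `d` is a square). [cite: SilvermanAEC2009, X.5 Cor. 5.4] -/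
theorem twistGeomEquiv_smul_of_eq (σ : Field.absoluteGaloisGroup F)
    (hσ : (show AlgebraicClosure F ≃ₐ[F] AlgebraicClosure F from σ) (geomSqrt d) = geomSqrt d) (P : A.geomPoints) :
    twistGeomEquiv W A C hd hA (σ • P) = σ • twistGeomEquiv W A C hd hA P := by
  simp only [twistGeomEquiv, AddEquiv.trans_apply]
  rw [geomPointsEquiv_smul, geomPointsCongr_smul, geomPointsCongr_smul, untwistEquiv_smul_of_eq _ hd σ hσ,
    AddEquiv.symm_apply_eq, geomPointsEquiv_smul, AddEquiv.apply_symm_apply]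

/-- **Galois law of `Θ`, `−` case**: `Θ(σ • P) = −(σ • Θ(P))` for every `σ ∈ Γ_F` with `σ(√d) = −√d` (the quadratic character of
`F(√d)/F`). [cite: SilvermanAEC2009, X.5 Cor. 5.4] -/
theorem twistGeomEquiv_smul_of_eq_neg (σ : Field.absoluteGaloisGroup F)
    (hσ : (show AlgebraicClosure F ≃ₐ[F] AlgebraicClosure F from σ) (geomSqrt d) = -geomSqrt d) (P : A.geomPoints) :
    twistGeomEquiv W A C hd hA (σ • P) = -(σ • twistGeomEquiv W A C hd hA P) := by
  simp only [twistGeomEquiv, AddEquiv.trans_apply]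
  rw [geomPointsEquiv_smul, geomPointsCongr_smul, geomPointsCongr_smul, untwistEquiv_smul_of_eq_neg _ hd σ hσ, map_neg]
  congr 1
  rw [AddEquiv.symm_apply_eq, geomPointsEquiv_smul, AddEquiv.apply_symm_apply]

/-! ## §4 The induced isomorphism of Tate modules -/

variable (p : ℕ) [Fact p.Prime]

/-- **`T_p Θ : T_p A ≃ₗ[ℤ_p] T_p W`**, the `ℤ_p`-linear isomorphism of Tate modules induced by the geometric untwisting (functoriality
`TateModule.map`; inverse = `T_p Θ⁻¹`). [cite: SilvermanAEC2009, III.§7] -/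
def twistTateEquiv : A.tateModule p ≃ₗ[ℤ_[p]] W.tateModule p :=
  LinearEquiv.ofLinear (TateModule.map p (twistGeomEquiv W A C hd hA).toAddMonoidHom)
    (TateModule.map p (twistGeomEquiv W A C hd hA).symm.toAddMonoidHom)
    (by rw [← TateModule.map_comp]; convert TateModule.map_id (A := W.geomPoints) (p := p); ext x; simp)
    (by rw [← TateModule.map_comp]; convert TateModule.map_id (A := A.geomPoints) (p := p); ext x; simp)

/-- Components of `T_p Θ`: `(T_p Θ a)_n = Θ(a_n)`. [cite: SilvermanAEC2009, III.§7] -/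
@[simp] theorem proj_twistTateEquiv (a : A.tateModule p) (n : ℕ) :
    TateModule.proj p n (twistTateEquiv W A C hd hA p a) = twistGeomEquiv W A C hd hA (TateModule.proj p n a) :=
  rfl

/-- **Galois law of `T_p Θ`**: `T_p Θ (σ • a) = σ • T_p Θ a` for every `σ ∈ Γ_F` fixing `√d` (componentwise from `twistGeomEquiv_smul_of_eq`).
[cite: SilvermanAEC2009, III.§7] -/
theorem twistTateEquiv_smul_of_eq (σ : Field.absoluteGaloisGroup F)
    (hσ : (show AlgebraicClosure F ≃ₐ[F] AlgebraicClosure F from σ) (geomSqrt d) = geomSqrt d) (a : A.tateModule p) :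
    twistTateEquiv W A C hd hA p (σ • a) = σ • twistTateEquiv W A C hd hA p a :=
  TateModule.ext fun n ↦ by
    rw [proj_twistTateEquiv, TateModule.proj_smul_of_distribMulAction, TateModule.proj_smul_of_distribMulAction,
      proj_twistTateEquiv, twistGeomEquiv_smul_of_eq W A C hd hA σ hσ]

end Untwist

/-! ## §5 The local untwisting `u_A : T_pA|_{Γ_{ℚ_v}} ⟶ T_pW|_{Γ_{ℚ_v}}` at a place where `√d ∈ ℚ_v` -/

section Local

open Literature.NumberTheory.GaloisRepresentations Literature.NumberTheory.EllipticCurves.Kato2004.EulerSystemValues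
open NumberField IsDedekindDomain

variable (W A : WeierstrassCurve ℚ) [W.IsElliptic] [A.IsElliptic] (C : VariableChange ℚ) {d : ℚ} (hd : d ≠ 0)
  (hA : C • A = W.quadraticTwist d) (p : ℕ) [Fact p.Prime]
  [ContinuousSMul ℤ_[p] (W.tateModule p)] [ContinuousSMul ℤ_[p] (A.tateModule p)]
  (v : HeightOneSpectrum (𝓞 ℚ))

/-- **The local untwisting at a place `v` of `ℚ` into whose completion `√d` descends** (`hsq`: the chosen embedding `ℚ̄ → ℚ̄_v` carries
`geomSqrt d` into `ℚ_v`; e.g. `v = (2)` for a Greenberg field, `d = d_K ≡ 1 (mod 8)`): the `ℤ_p`-isomorphism `T_p Θ` IS a morphism of the LOCAL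
topological Galois representations `(T_pA)|_{Γ_{ℚ_v}} ⟶ (T_pW)|_{Γ_{ℚ_v}}` — every `τ ∈ Γ_{ℚ_v}` restricts to an element of `Γ_ℚ` fixing `√d`
(`absGaloisRestrict_smul_eq_of_mem_range`), where `T_p Θ` is equivariant (`twistTateEquiv_smul_of_eq`); continuity: `TateModule.continuous_map`.
This is the GEOMETRIC value of the parameter `uA` of `PinnedKatoGreenbergDatum` (carrier want C5). [cite: SilvermanAEC2009, X.5 Cor. 5.4 and III.§7] -/
def twistLocalHom
    (hsq : absClosureEmbedding ℚ (v.adicCompletion ℚ) (geomSqrt d) ∈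
      Set.range (algebraMap (v.adicCompletion ℚ) (AlgebraicClosure (v.adicCompletion ℚ)))) :
    ((tateRep A p).toLocal v).toTopRep ⟶ ((tateRep W p).toLocal v).toTopRep :=
  TopRep.ofHom
    { toLinearMap := (twistTateEquiv W A C hd hA p).toLinearMap
      cont := TateModule.continuous_map continuous_of_discreteTopology
      isIntertwining' := fun τ ↦ ContinuousLinearMap.ext fun a ↦ by
        have hτ : (show AlgebraicClosure ℚ ≃ₐ[ℚ] AlgebraicClosure ℚ from
            absGaloisRestrict ℚ (v.adicCompletion ℚ) τ) (geomSqrt d) = geomSqrt d :=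
          absGaloisRestrict_smul_eq_of_mem_range ℚ v τ hsq
        change twistTateEquiv W A C hd hA p (absGaloisRestrict ℚ (v.adicCompletion ℚ) τ • a) =
          absGaloisRestrict ℚ (v.adicCompletion ℚ) τ • twistTateEquiv W A C hd hA p a
        exact twistTateEquiv_smul_of_eq W A C hd hA p _ hτ a }

/-- `twistLocalHom` is `T_p Θ` on elements. [cite: SilvermanAEC2009, III.§7] -/
@[simp] theorem twistLocalHom_hom_apply
    (hsq : absClosureEmbedding ℚ (v.adicCompletion ℚ) (geomSqrt d) ∈
      Set.range (algebraMap (v.adicCompletion ℚ) (AlgebraicClosure (v.adicCompletion ℚ))))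
    (a : A.tateModule p) :
    (twistLocalHom W A C hd hA p v hsq).hom a = twistTateEquiv W A C hd hA p a := rfl

/-- `twistLocalHom` is bijective (it is the linear equivalence `T_p Θ`) — the field `uA_bijective` of `PinnedKatoGreenbergDatum` for the
geometric `uA`. [cite: SilvermanAEC2009, III.§7] -/
theorem twistLocalHom_bijective
    (hsq : absClosureEmbedding ℚ (v.adicCompletion ℚ) (geomSqrt d) ∈
      Set.range (algebraMap (v.adicCompletion ℚ) (AlgebraicClosure (v.adicCompletion ℚ)))) :
    Function.Bijective (twistLocalHom W A C hd hA p v hsq).hom :=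
  (twistTateEquiv W A C hd hA p).bijective

end Local

/-! ## §6 Discharging `hsq`: `√d` descends to `ℚ_v` when `d` is a square there; at `v = (2)` for `d ≡ 1 (mod 8)` -/

section Descend

open Literature.NumberTheory.GaloisRepresentations Literature.NumberTheory.QuadraticForms
open NumberField IsDedekindDomain Rat.HeightOneSpectrum

/-- If `d` is a square in `ℚ_v` then the chosen embedding `ℚ̄ → ℚ̄_v` carries `geomSqrt d` into `ℚ_v` (both square roots of `d` in `ℚ̄_v` lie in
`ℚ_v`). [folklore] -/
theorem absClosureEmbedding_geomSqrt_mem_range (v : HeightOneSpectrum (𝓞 ℚ)) {d : ℚ}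
    (hsq : IsSquare (algebraMap ℚ (v.adicCompletion ℚ) d)) :
    absClosureEmbedding ℚ (v.adicCompletion ℚ) (geomSqrt d) ∈
      Set.range (algebraMap (v.adicCompletion ℚ) (AlgebraicClosure (v.adicCompletion ℚ))) := by
  obtain ⟨y, hy⟩ := hsq
  have hx : (absClosureEmbedding ℚ (v.adicCompletion ℚ) (geomSqrt d)) ^ 2 =
      (algebraMap (v.adicCompletion ℚ) (AlgebraicClosure (v.adicCompletion ℚ)) y) ^ 2 := by
    rw [← map_pow, geomSqrt_sq, AlgHom.commutes,
      IsScalarTower.algebraMap_apply ℚ (v.adicCompletion ℚ) (AlgebraicClosure (v.adicCompletion ℚ)), hy, map_mul, sq]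
  rcases sq_eq_sq_iff_eq_or_eq_neg.mp hx with h | h
  · exact ⟨y, h.symm⟩
  · exact ⟨-y, by rw [map_neg, h]⟩

/-- **At `v = (2)`**: for an integer `D ≡ 1 (mod 8)` (e.g. the discriminant of a Greenberg field, `discr_emod_eight_of_greenbergField`), `√D`
descends to `ℚ₂` (Hensel at `2`: tree `padic_isSquare_intCast_of_mod_eight`, transported to `v.adicCompletion ℚ` by
`TwoDescentLocal.isSquare_algebraMap_adicCompletion_of_padic'`). So `twistLocalHom … v` is available at the prime `2` for every pair `(A, W)` with
`C • A = W^{(d_K)}`. [cite: Serre1973, Ch. II §3.3 Thm 4] -/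
theorem absClosureEmbedding_geomSqrt_mem_range_two (v : HeightOneSpectrum (𝓞 ℚ)) (hv : (primesEquiv v : ℕ) = 2) {D : ℤ}
    (hD : D % 8 = 1) :
    absClosureEmbedding ℚ (v.adicCompletion ℚ) (geomSqrt (D : ℚ)) ∈
      Set.range (algebraMap (v.adicCompletion ℚ) (AlgebraicClosure (v.adicCompletion ℚ))) := by
  haveI : Fact (Nat.Prime 2) := ⟨Nat.prime_two⟩
  refine absClosureEmbedding_geomSqrt_mem_range v ?_
  refine TwoDescentLocal.isSquare_algebraMap_adicCompletion_of_padic' v hv ?_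
  rw [Rat.cast_intCast]
  exact padic_isSquare_intCast_of_mod_eight rfl hD

end Descend

end Summit.BirchSwinnertonDyer.BirchSwinnertonDyer.Theorems.TwoAdicKatoDeterminant

end
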